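import Summits.Parity.GeneralizedHardyLittlewood.Theorems.LeeYangFibresRelativeDimOneNecessityDefs
import Literature.NumberTheory.Sieve.LargeSieveCharacters
import Literature.NumberTheory.LFunctions.RHWave0PNTProofs
import HarnessLib

/-!
# Route `LeeYangFibres`, crux `RelativeDimOne` (stmt-Parity-14113), line `SketchIdeator1`, cycle 2:
certificate A2 `characterNecessity` — a sharp class second moment forces uniform character PNT

Certificate A2 of the idea card `Cruxes/RelativeDimOne/Ideas/gallagher-backwards-split.md`
(`characterNecessity : SharpClassSecondMoment → UniformCharPNT`, a registered sub-goal of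
stmt-Parity-14113; vocabulary in `LeeYangFibresRelativeDimOneNecessityDefs.lean`): if for every
modulus `1 ≤ q ≤ N` the primes in residue classes have the SHARP second moment
`∑_{a mod q} ψ(N;q,a)² ≤ (1+ε)(N²/φ(q) + N log N)` (`N ≥ N₀(ε)`), then `ψ(N, χ) = o(N)` for every
non-principal Dirichlet character `χ mod q`, uniformly in `2 ≤ q ≤ N^θ`, for every `θ < 1`.

## Proof

Fix `θ < 1`, `ε₀ > 0`, and a working accuracy `ε ≍ ε₀²`.
* Orthogonality (`CharacterNecessity.charPsi_eq_sum_range`,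
  `CharacterNecessity.sum_norm_sq_charPsi_le`): grouping `n ≤ N` by residues,
  `ψ(N,χ) = ∑_{b mod q} χ(b) ψ(N;q,b)`, so Parseval on `(ℤ/qℤ)ˣ`
  (`Literature.NumberTheory.Sieve.LargeSieve.sum_norm_sq_sum_char_mul`) and the hypothesis give
  `∑_χ |ψ(N,χ)|² = φ(q) ∑_{(b,q)=1} ψ(N;q,b)² ≤ (1+ε)(N² + φ(q) N log N)`.
* Principal character (`CharacterNecessity.charPsi_one`, `CharacterNecessity.theta_sub_log_le`):
  `ψ(N,χ₀) = ∑_{n ≤ N, (n,q)=1} Λ(n) ≥ ϑ(N) − ∑_{p ∣ q} log p ≥ ϑ(N) − log q ≥ (1−ε)N − log N`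
  by the prime number theorem `ϑ(N) ~ N`
  (`Literature.NumberTheory.LFunctions.chebyshevTheta_isEquivalent`), so `|ψ(N,χ₀)|² ≥ (1−4ε)N²`.
* Isolation (`CharacterNecessity.norm_sq_add_norm_sq_le`): for `χ ≠ χ₀`,
  `|ψ(N,χ)|² ≤ ∑_{χ'} |ψ(N,χ')|² − |ψ(N,χ₀)|² ≤ 5εN² + (1+ε) φ(q) N log N`, and for `q ≤ N^θ`,
  `φ(q) N log N ≤ N^{1+θ} log N ≤ ε N²` eventually (`log N = o(N^{1−θ})`), whence
  `|ψ(N,χ)|² ≤ 7εN² ≤ ε₀²N²`.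

References: Gallagher, Mathematika 23 (1976) [Gallagher1976]; Friedlander–Goldston, Quart. J. Math.
47 (1996) Prop. 1 [FriedlanderGoldston1996]; Davenport, *Multiplicative Number Theory*, 2nd ed.
(1980), chs. 18–20 [DavenportMNT1980].
-/

noncomputable section

open scoped BigOperators ArithmeticFunction.vonMangoldt
open Finset Filter Asymptotics

namespace Summit.Parity.GeneralizedHardyLittlewood.Cruxes.RelativeDimOne.GallagherBackwards

namespace CharacterNecessity

/-! ### Orthogonality: `∑_χ |ψ(N,χ)|² ≤ φ(q) ∑_a ψ(N;q,a)²` -/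

section Orthogonality

variable {q : ℕ} [NeZero q]

/-- Grouping `1 ≤ n ≤ N` by residues: `ψ(N, χ) = ∑_{0 ≤ b < q} χ(b) ψ(N; q, b)`. -/
theorem charPsi_eq_sum_range (χ : DirichletCharacter ℂ q) (N : ℕ) :
    charPsi χ N = ∑ b ∈ range q, χ b * (classPsi N q b : ℂ) := by
  have hq : 0 < q := Nat.pos_of_ne_zero (NeZero.ne q)
  unfold charPsi classPsi
  rw [← Finset.sum_fiberwise_of_maps_to (s := Icc 1 N) (t := range q) (g := fun n => n % q)
    (fun n _ => mem_range.2 (Nat.mod_lt n hq))]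
  refine sum_congr rfl fun b _ => ?_
  rw [Complex.ofReal_sum, mul_sum]
  refine sum_congr rfl fun n hn => ?_
  rw [← ZMod.natCast_mod n q, (mem_filter.1 hn).2, mul_comm]

/-- Parseval on `(ℤ/qℤ)ˣ` (orthogonality of characters in mean square):
`∑_{χ mod q} |ψ(N, χ)|² = φ(q) ∑_{(a,q)=1} ψ(N;q,a)² ≤ φ(q) ∑_{a mod q} ψ(N;q,a)²`. -/
theorem sum_norm_sq_charPsi_le (N : ℕ) :
    ∑ χ : DirichletCharacter ℂ q, ‖charPsi χ N‖ ^ 2 ≤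
      (q.totient : ℝ) * ∑ a ∈ range q, classPsi N q a ^ 2 := by
  calc ∑ χ : DirichletCharacter ℂ q, ‖charPsi χ N‖ ^ 2
      = ∑ χ : DirichletCharacter ℂ q, ‖∑ b ∈ range q, χ b * (classPsi N q b : ℂ)‖ ^ 2 :=
        Fintype.sum_congr _ _ fun χ => by rw [charPsi_eq_sum_range]
    _ = q.totient * ∑ b ∈ range q with b.Coprime q, ‖(classPsi N q b : ℂ)‖ ^ 2 :=
        Literature.NumberTheory.Sieve.LargeSieve.sum_norm_sq_sum_char_mul _
    _ = q.totient * ∑ b ∈ range q with b.Coprime q, classPsi N q b ^ 2 := by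
        congr 1
        refine sum_congr rfl fun b _ => ?_
        rw [Complex.norm_real, Real.norm_eq_abs, sq_abs]
    _ ≤ (q.totient : ℝ) * ∑ a ∈ range q, classPsi N q a ^ 2 :=
        mul_le_mul_of_nonneg_left
          (sum_le_sum_of_subset_of_nonneg (filter_subset _ _) fun _ _ _ => sq_nonneg _)
          (Nat.cast_nonneg _)

/-- Isolating one character: for `χ ≠ χ₀`, `|ψ(N,χ)|² + |ψ(N,χ₀)|² ≤ ∑_{χ'} |ψ(N,χ')|²`. -/
theorem norm_sq_add_norm_sq_le {χ : DirichletCharacter ℂ q} (hχ : χ ≠ 1) (N : ℕ) :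
    ‖charPsi χ N‖ ^ 2 + ‖charPsi (1 : DirichletCharacter ℂ q) N‖ ^ 2 ≤
      ∑ χ' : DirichletCharacter ℂ q, ‖charPsi χ' N‖ ^ 2 := by
  classical
  calc ‖charPsi χ N‖ ^ 2 + ‖charPsi (1 : DirichletCharacter ℂ q) N‖ ^ 2
      = ∑ χ' ∈ ({χ, 1} : Finset (DirichletCharacter ℂ q)), ‖charPsi χ' N‖ ^ 2 :=
        (sum_pair (f := fun χ' : DirichletCharacter ℂ q => ‖charPsi χ' N‖ ^ 2) hχ).symm
    _ ≤ ∑ χ' : DirichletCharacter ℂ q, ‖charPsi χ' N‖ ^ 2 :=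
        sum_le_sum_of_subset_of_nonneg (subset_univ _) fun _ _ _ => sq_nonneg _

end Orthogonality

/-! ### The principal character: `ψ(N, χ₀) ≥ ϑ(N) − log q` -/

/-- For the principal character, `ψ(N, χ₀) = ∑_{n ≤ N, (n,q)=1} Λ(n)`. -/
theorem charPsi_one (q N : ℕ) :
    charPsi (1 : DirichletCharacter ℂ q) N =
      ((∑ n ∈ (Icc 1 N).filter (fun n => n.Coprime q), Λ n : ℝ) : ℂ) := by
  unfold charPsi
  rw [Complex.ofReal_sum, sum_filter]
  refine sum_congr rfl fun n _ => ?_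
  by_cases h : n.Coprime q
  · rw [if_pos h, MulChar.one_apply ((ZMod.isUnit_iff_coprime n q).2 h), mul_one]
  · rw [if_neg h, MulChar.map_nonunit _ (mt (ZMod.isUnit_iff_coprime n q).1 h), mul_zero]

/-- `ϑ(N) − log q ≤ ∑_{n ≤ N, (n,q)=1} Λ(n)` for `q ≥ 1`: the primes `p ≤ N` not dividing `q` are
among the `n` counted, and the primes dividing `q` contribute `∑_{p ∣ q} log p ≤ log q`. -/
theorem theta_sub_log_le {q : ℕ} (hq : 0 < q) (N : ℕ) :
    Chebyshev.theta N - Real.log q ≤ ∑ n ∈ (Icc 1 N).filter (fun n => n.Coprime q), Λ n := by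
  have hI : Icc 1 N = Ioc 0 N := by
    ext n
    simp only [mem_Icc, mem_Ioc]
    omega
  set S := (Icc 1 N).filter Nat.Prime with hS
  have hθ : Chebyshev.theta N = ∑ p ∈ S, Real.log p := by
    rw [Chebyshev.theta, Nat.floor_natCast, hS, hI]
  have hsplit : ∑ p ∈ S, Real.log p =
      ∑ p ∈ S with p.Coprime q, Real.log p + ∑ p ∈ S with ¬p.Coprime q, Real.log p :=
    (sum_filter_add_sum_filter_not S (fun p => p.Coprime q) _).symm
  -- primes coprime to `q` are counted by the right-hand side
  have h1 : ∑ p ∈ S with p.Coprime q, Real.log p ≤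
      ∑ n ∈ (Icc 1 N).filter (fun n => n.Coprime q), Λ n := by
    have heq : ∑ p ∈ S with p.Coprime q, Real.log p = ∑ n ∈ S with n.Coprime q, Λ n := by
      refine sum_congr rfl fun p hp => ?_
      rw [ArithmeticFunction.vonMangoldt_apply_prime (mem_filter.1 (mem_filter.1 hp).1).2]
    rw [heq]
    refine sum_le_sum_of_subset_of_nonneg (fun p hp => ?_)
      fun _ _ _ => ArithmeticFunction.vonMangoldt_nonneg
    simp only [hS, mem_filter] at hp ⊢
    exact ⟨hp.1.1, hp.2⟩
  -- primes dividing `q` contribute at most `log q`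
  have h2 : ∑ p ∈ S with ¬p.Coprime q, Real.log p ≤ Real.log q := by
    calc ∑ p ∈ S with ¬p.Coprime q, Real.log p
        ≤ ∑ p ∈ q.primeFactors, Real.log p := by
          refine sum_le_sum_of_subset_of_nonneg (fun p hp => ?_) fun p hp _ =>
            Real.log_nonneg (by exact_mod_cast (Nat.prime_of_mem_primeFactors hp).one_le)
          simp only [hS, mem_filter] at hp
          exact Nat.mem_primeFactors.2 ⟨hp.1.2, hp.1.2.dvd_iff_not_coprime.2 hp.2, hq.ne'⟩
      _ = Real.log (∏ p ∈ q.primeFactors, (p : ℝ)) := by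
          rw [Real.log_prod]
          exact fun p hp => by exact_mod_cast (Nat.prime_of_mem_primeFactors hp).ne_zero
      _ ≤ Real.log q := by
          refine Real.log_le_log (prod_pos fun p hp => ?_) ?_
          · exact_mod_cast (Nat.prime_of_mem_primeFactors hp).pos
          · have h : ((∏ p ∈ q.primeFactors, p : ℕ) : ℝ) ≤ q := by
              exact_mod_cast Nat.le_of_dvd hq (Nat.prod_primeFactors_dvd q)
            simpa [Nat.cast_prod] using h
  linarith [hθ, hsplit, h1, h2]

/-! ### Eventual inequalities along `N → ∞` -/

/-- Prime number theorem for `ϑ`, lower half: `ϑ(N) ≥ (1 − ε)N` for `N ≥ N₀(ε)`. -/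
theorem eventually_theta_ge {ε : ℝ} (hε : 0 < ε) :
    ∀ᶠ N : ℕ in atTop, (1 - ε) * N ≤ Chebyshev.theta N := by
  have h := tendsto_natCast_atTop_atTop.eventually
    (Literature.NumberTheory.LFunctions.chebyshevTheta_isEquivalent.isLittleO.def hε)
  filter_upwards [h] with N hN
  rw [Pi.sub_apply, Real.norm_eq_abs, Real.norm_of_nonneg (Nat.cast_nonneg N)] at hN
  have := (abs_le.1 hN).1
  linarith

/-- `log N ≤ ε N` for `N ≥ N₀(ε)`. -/
theorem eventually_log_le {ε : ℝ} (hε : 0 < ε) :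
    ∀ᶠ N : ℕ in atTop, Real.log N ≤ ε * N := by
  have h := tendsto_natCast_atTop_atTop.eventually (Real.isLittleO_log_id_atTop.def hε)
  filter_upwards [h] with N hN
  rw [id, Real.norm_eq_abs, Real.norm_of_nonneg (Nat.cast_nonneg N)] at hN
  exact (le_abs_self _).trans hN

/-- `log N ≤ ε N^{δ}` for `N ≥ N₀(ε, δ)`, `δ > 0`. -/
theorem eventually_log_le_rpow {ε δ : ℝ} (hε : 0 < ε) (hδ : 0 < δ) :
    ∀ᶠ N : ℕ in atTop, Real.log N ≤ ε * (N : ℝ) ^ δ := by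
  have h := tendsto_natCast_atTop_atTop.eventually ((isLittleO_log_rpow_atTop hδ).def hε)
  filter_upwards [h] with N hN
  rw [Real.norm_eq_abs, Real.norm_of_nonneg (Real.rpow_nonneg (Nat.cast_nonneg N) _)] at hN
  exact (le_abs_self _).trans hN

end CharacterNecessity

/-- **Certificate A2** of the card `gallagher-backwards-split` (registered sub-goal of
stmt-Parity-14113): a sharp second moment of primes in residue classes for all moduli `q ≤ N`
forces `ψ(N, χ) = o(N)` for every non-principal character `χ mod q`, uniformly in `q ≤ N^θ`,
every `θ < 1` — by orthogonality of characters (Parseval on `(ℤ/qℤ)ˣ`), the prime number theorem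
for the principal character, and `φ(q) N log N = o(N²)` for `q ≤ N^θ`. -/
theorem characterNecessity : SharpClassSecondMoment → UniformCharPNT := by
  intro h θ hθ ε₀ hε₀
  -- working accuracy `ε`: `8ε ≤ ε₀²`, `ε ≤ 1/2`
  obtain ⟨ε, hε, hε1, hε2⟩ : ∃ ε : ℝ, 0 < ε ∧ ε ≤ 1 / 2 ∧ ε ≤ ε₀ ^ 2 / 8 :=
    ⟨min (1 / 2) (ε₀ ^ 2 / 8), lt_min (by norm_num) (by positivity), min_le_left _ _,
      min_le_right _ _⟩
  obtain ⟨N₁, hN₁⟩ := h ε hε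
  obtain ⟨N₀, hN₀⟩ := eventually_atTop.1 ((eventually_ge_atTop (max N₁ 2)).and
    ((CharacterNecessity.eventually_theta_ge hε).and ((CharacterNecessity.eventually_log_le hε).and
      (CharacterNecessity.eventually_log_le_rpow hε (sub_pos.2 hθ)))))
  refine ⟨N₀, fun N hN q hq hqN χ hχ => ?_⟩
  obtain ⟨hNge, hE2, hE3, hE4⟩ := hN₀ N hN
  have hN₁N : N₁ ≤ N := le_of_max_le_left hNge
  have hN2 : 2 ≤ N := le_of_max_le_right hNge
  haveI : NeZero q := ⟨by omega⟩
  have hq0 : 0 < q := by omega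
  have hNpos : (0 : ℝ) < N := by exact_mod_cast (by omega : 0 < N)
  have hN1 : (1 : ℝ) ≤ N := by exact_mod_cast (by omega : 1 ≤ N)
  -- `q ≤ N^θ ≤ N`
  have hqN' : (q : ℝ) ≤ N := by
    refine hqN.trans ?_
    calc (N : ℝ) ^ θ ≤ (N : ℝ) ^ (1 : ℝ) := Real.rpow_le_rpow_of_exponent_le hN1 hθ.le
      _ = N := Real.rpow_one _
  have hqNnat : q ≤ N := by exact_mod_cast hqN'
  have hφpos : (0 : ℝ) < q.totient := by exact_mod_cast Nat.totient_pos.2 hq0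
  have hφq : (q.totient : ℝ) ≤ q := by exact_mod_cast Nat.totient_le q
  have hlogN : 0 ≤ Real.log N := Real.log_nonneg hN1
  -- (P) total mean square: `∑_χ |ψ(N,χ)|² ≤ (1+ε)(N² + φ(q) N log N)`
  have htot : ∑ χ' : DirichletCharacter ℂ q, ‖charPsi χ' N‖ ^ 2 ≤
      (1 + ε) * ((N : ℝ) ^ 2 + q.totient * (N * Real.log N)) := by
    calc ∑ χ' : DirichletCharacter ℂ q, ‖charPsi χ' N‖ ^ 2
        ≤ (q.totient : ℝ) * ∑ a ∈ range q, classPsi N q a ^ 2 :=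
          CharacterNecessity.sum_norm_sq_charPsi_le N
      _ ≤ (q.totient : ℝ) * ((1 + ε) * ((N : ℝ) ^ 2 / q.totient + N * Real.log N)) :=
          mul_le_mul_of_nonneg_left (hN₁ N hN₁N q hq0 hqNnat) hφpos.le
      _ = (1 + ε) *
            ((q.totient : ℝ) * ((N : ℝ) ^ 2 / q.totient) + q.totient * (N * Real.log N)) := by
          ring
      _ = (1 + ε) * ((N : ℝ) ^ 2 + q.totient * (N * Real.log N)) := by
          rw [mul_div_cancel₀ _ hφpos.ne']
  -- (1) principal character: `|ψ(N,χ₀)| ≥ ϑ(N) − log q ≥ (1 − 2ε) N`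
  have hprin : (1 - 2 * ε) * N ≤ ‖charPsi (1 : DirichletCharacter ℂ q) N‖ := by
    rw [CharacterNecessity.charPsi_one, Complex.norm_of_nonneg
      (sum_nonneg fun _ _ => ArithmeticFunction.vonMangoldt_nonneg)]
    have h1 := CharacterNecessity.theta_sub_log_le hq0 N
    have h2 : Real.log q ≤ ε * N :=
      (Real.log_le_log (by exact_mod_cast hq0) hqN').trans hE3
    linarith
  have hprin2 : (1 - 4 * ε) * (N : ℝ) ^ 2 ≤ ‖charPsi (1 : DirichletCharacter ℂ q) N‖ ^ 2 := by
    have h0 : 0 ≤ (1 - 2 * ε) * N := mul_nonneg (by linarith) hNpos.le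
    calc (1 - 4 * ε) * (N : ℝ) ^ 2 ≤ ((1 - 2 * ε) * N) ^ 2 := by nlinarith [sq_nonneg (ε * N)]
      _ ≤ _ := pow_le_pow_left₀ h0 hprin 2
  -- the error term: `φ(q) N log N ≤ N^θ · N · ε N^{1−θ} = ε N²`
  have herr : (q.totient : ℝ) * (N * Real.log N) ≤ ε * (N : ℝ) ^ 2 := by
    calc (q.totient : ℝ) * (N * Real.log N)
        ≤ (N : ℝ) ^ θ * (N * Real.log N) :=
          mul_le_mul_of_nonneg_right (hφq.trans hqN) (mul_nonneg hNpos.le hlogN)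
      _ ≤ (N : ℝ) ^ θ * (N * (ε * (N : ℝ) ^ (1 - θ))) :=
          mul_le_mul_of_nonneg_left (mul_le_mul_of_nonneg_left hE4 hNpos.le)
            (Real.rpow_nonneg hNpos.le _)
      _ = ε * N * ((N : ℝ) ^ θ * (N : ℝ) ^ (1 - θ)) := by ring
      _ = ε * (N : ℝ) ^ 2 := by
          rw [← Real.rpow_add hNpos, add_sub_cancel, Real.rpow_one]
          ring
  -- (2) isolation of `χ ≠ χ₀`
  have hiso := CharacterNecessity.norm_sq_add_norm_sq_le hχ N
  have key : ‖charPsi χ N‖ ^ 2 ≤ (ε₀ * N) ^ 2 := by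
    have hA : (0 : ℝ) ≤ (N : ℝ) ^ 2 := sq_nonneg _
    have h1 : (1 + ε) * ((q.totient : ℝ) * (N * Real.log N)) ≤ (1 + ε) * (ε * (N : ℝ) ^ 2) :=
      mul_le_mul_of_nonneg_left herr (by linarith)
    have h3 : ε * (N : ℝ) ^ 2 ≤ ε₀ ^ 2 / 8 * (N : ℝ) ^ 2 := mul_le_mul_of_nonneg_right hε2 hA
    have h4 : ε * (ε * (N : ℝ) ^ 2) ≤ 1 / 2 * (ε * (N : ℝ) ^ 2) :=
      mul_le_mul_of_nonneg_right hε1 (by positivity)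
    have h5 : (0 : ℝ) ≤ ε₀ ^ 2 * (N : ℝ) ^ 2 := by positivity
    linarith [hiso, htot, hprin2, h1, h3, h4, h5]
  exact (sq_le_sq₀ (norm_nonneg _) (by positivity)).1 key

end Summit.Parity.GeneralizedHardyLittlewood.Cruxes.RelativeDimOne.GallagherBackwards
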